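import Summits.AtomisticToContinuum.Crystallization.Theorems.SpectralChargeLedgerSummedShellPricingEquivalences

/-!
# Crux `SummedShellPricing` (stmt-AtomisticToContinuum-17044, K1): K1 forces EXACT relaxed-Barlow first shells,
# at ONE cell, on every periodic Lennard-Jones ground state (the route's kill criterion, formal)

By the torus form of K1 (`SummedShellPricingEquivalences.summedShellPricing_iff_torus`, p167766), a periodic
configuration `P` of `ℝ³` with `1/3`-separated point set that attains `e⋆ = ⨅_Q e(Q)` satisfies
`κ(τ)·#{τ-bad motif points} ≤ #motif·(e(P) − e⋆) = 0`, hence has NO τ-bad motif point, for every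
`τ ∈ (0,1]`: all its first shells are τ-matched (linear isometry + bijection) to the 12-shell of
`hcpStacking a₀ h₀` or `fccStacking a₀ h₀` at the single cell `(a₀,h₀)` of K1.  Contrapositive = the
route's KILL CRITERION for K1 (thesis of `SpectralChargeLedger`): a periodic LJ ground state with
`1/3`-separated points that is not exactly Barlow-shelled at one common box cell — a relaxed two-gap
polytype (4H/6H/9R-type), a non-Barlow phase — refutes K1.  Registered sub-goal
`stub_periodicMinimisersExact` of the skeleton `Cruxes/SummedShellPricing/Lines/Sketch.lean`; all `[folklore]`.
-/

noncomputable section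

namespace Summit.AtomisticToContinuum.Crystallization.Theorems.SummedShellPricingPeriodicMinimisers

open scoped BigOperators Classical
open Literature.MathematicalPhysics.StatisticalMechanics Literature.Geometry.DiscreteGeometry

/-- If `κ > 0` and `κ·#(s.filter Bad) ≤ 0` then no element of `s` is `Bad`. [folklore] -/
theorem forall_not_of_mul_card_filter_nonpos {α : Type*} (s : Finset α) (Bad : α → Prop) [DecidablePred Bad]
    {κ : ℝ} (hκ : 0 < κ) (h : κ * ((s.filter Bad).card : ℝ) ≤ 0) : ∀ q ∈ s, ¬ Bad q := by
  intro q hq hb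
  have hmem : q ∈ s.filter Bad := Finset.mem_filter.2 ⟨hq, hb⟩
  have hpos : (0 : ℝ) < ((s.filter Bad).card : ℝ) := by exact_mod_cast Finset.card_pos.2 ⟨q, hmem⟩
  nlinarith

/-- **K1 ⇒ periodic ground states are exactly Barlow-shelled at one cell** (registered sub-goal
`stub_periodicMinimisersExact` of line `Sketch`, crux stmt-AtomisticToContinuum-17044): if
`SummedShellPricing` holds then there is ONE cell `(a₀,h₀)` in the box such that every periodic
configuration of `ℝ³` with `1/3`-separated point set attaining the periodic Lennard-Jones infimum has,
for every `τ ∈ (0,1]`, all its motif points τ-good (first shell τ-matched, after a linear isometry and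
bijectively, to the relaxed hcp or fcc 12-shell at `(a₀,h₀)`).  Proof: torus K1
(`summedShellPricing_iff_torus`) with `e(P) − e⋆ = 0` gives `κ·#bad ≤ 0`, `κ > 0`. [folklore] -/
theorem stub_periodicMinimisersExact :
    Summit.AtomisticToContinuum.Crystallization.Theses.SpectralChargeLedger.SummedShellPricing →
    ∃ a₀ h₀ : ℝ, 47 / 50 ≤ a₀ ∧ a₀ ≤ 1 ∧ |h₀ - a₀ * Real.sqrt (2 / 3)| ≤ a₀ / 100 ∧
      ∀ P : PeriodicConfiguration 3, (∀ u ∈ P.points, ∀ v ∈ P.points, u ≠ v → (1 / 3 : ℝ) ≤ dist u v) →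
        P.energyPerParticle lennardJones = (⨅ Q : PeriodicConfiguration 3, Q.energyPerParticle lennardJones) →
        ∀ τ : ℝ, 0 < τ → τ ≤ 1 → ∀ q ∈ P.motif,
          (∃ A : EuclideanSpace ℝ (Fin 3) →ₗᵢ[ℝ] EuclideanSpace ℝ (Fin 3),
              (∃ e : ↥{z : EuclideanSpace ℝ (Fin 3) | z ∈ P.points ∧ z ≠ q ∧ dist z (q) < 13 / 10 * a₀} ≃
                  ↥{p : EuclideanSpace ℝ (Fin 3) | p ∈ hcpStacking a₀ h₀ ∧ p ≠ 0 ∧ ‖p‖ < 13 / 10 * a₀},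
                ∀ t : ↥{z : EuclideanSpace ℝ (Fin 3) | z ∈ P.points ∧ z ≠ q ∧ dist z (q) < 13 / 10 * a₀},
                  dist ((t : EuclideanSpace ℝ (Fin 3)) - q)
                    (A ((e t : ↥{p : EuclideanSpace ℝ (Fin 3) | p ∈ hcpStacking a₀ h₀ ∧ p ≠ 0 ∧ ‖p‖ < 13 / 10 * a₀}) : EuclideanSpace ℝ (Fin 3))) ≤ τ) ∨
              (∃ e : ↥{z : EuclideanSpace ℝ (Fin 3) | z ∈ P.points ∧ z ≠ q ∧ dist z (q) < 13 / 10 * a₀} ≃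
                  ↥{p : EuclideanSpace ℝ (Fin 3) | p ∈ fccStacking a₀ h₀ ∧ p ≠ 0 ∧ ‖p‖ < 13 / 10 * a₀},
                ∀ t : ↥{z : EuclideanSpace ℝ (Fin 3) | z ∈ P.points ∧ z ≠ q ∧ dist z (q) < 13 / 10 * a₀},
                  dist ((t : EuclideanSpace ℝ (Fin 3)) - q)
                    (A ((e t : ↥{p : EuclideanSpace ℝ (Fin 3) | p ∈ fccStacking a₀ h₀ ∧ p ≠ 0 ∧ ‖p‖ < 13 / 10 * a₀}) : EuclideanSpace ℝ (Fin 3))) ≤ τ)) := by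
  intro hK1
  obtain ⟨a₀, h₀, hb1, hb2, hb3, hT⟩ := SummedShellPricingEquivalences.summedShellPricing_iff_torus.1 hK1
  refine ⟨a₀, h₀, hb1, hb2, hb3, fun P hsep hmin τ hτ hτ1 => ?_⟩
  obtain ⟨κ, hκ, hP⟩ := hT τ hτ hτ1
  have h := hP P hsep
  rw [hmin, sub_self, mul_zero] at h
  have key := forall_not_of_mul_card_filter_nonpos P.motif _ hκ h
  intro q hq
  by_contra hbad
  exact key q hq hbad

end Summit.AtomisticToContinuum.Crystallization.Theorems.SummedShellPricingPeriodicMinimisers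

end
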